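import Summits.BirchSwinnertonDyer.BirchSwinnertonDyer.Theses.ThetaPartnerAtTwo
import Literature.NumberTheory.EllipticCurves.ComplexMultiplication
import HarnessLib

/-!
# Route `ThetaPartnerAtTwo`, crux K2 `SignedMainConjectureCMTwo` (item stmt-BirchSwinnertonDyer-20307):
# the BC3 composition against the route decl, the Pollack–Rubin body READ AT `p = 2`, and the
# trivial-character (`T = 0`) shadow of the crux — PROVED from BSD₂(A) + Kim's control at `2`

HONEST FRAMING (cell `pub/bsd-wall`, W-ALL row 1, prover seat `bsd-wall-tp2-p2`): the crux
`Summit.BirchSwinnertonDyer.BirchSwinnertonDyer.Theses.ThetaPartnerAtTwo.SignedMainConjectureCMTwo`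
("for every CM curve `A/ℚ` good supersingular at `2` with `a₂ = 0`: `X⁺(A/ℚ_∞)` is `Λ`-torsion with
`μ⁺ = 0`, and Kobayashi's `+` main conjecture holds at `2`") is the Pollack–Rubin theorem
(Ann. of Math. 159 (2004), Thm. 7.3; tree fact
`Literature.NumberTheory.EllipticCurves.PollackRubin2004.mainTheorem_signedCharIdeal_eq_of_cm`, typed
with the source's guard `p ≠ 2`) PORTED to `p = 2`, plus `μ⁺ = 0`. NOTHING of it is in print at `2`
(barrier `Literature.Barriers.BirchSwinnertonDyer.SignedIwasawaTheoryAtTwoBarrier`: every algebraic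
signed fact of the tree begins `p ≠ 2 →`; Kurihara–Otsuki, PAMQ 2 (2006) p. 557, ASSERT without proof
that for `a₂ = 0` "we can define ± Selmer groups as in Kobayashi, and can study them by the same
method as for `p > 2`"). This file does NOT prove the crux and asserts nothing about it. It records,
sorry-free:

* §1 `signedMainConjectureCMTwo_of_structure_of_mainConjecture` — the registered BC3 composition
  (skeleton `Cruxes/…/SignedMainConjectureCMTwo_birth.lean`, stubs `stub_cmSignedStructureTwo`,
  `stub_cmSignedMainConjectureTwo`) with the two stubs as displayed hypotheses, concluding the route
  decl BY NAME; and `signedMainConjectureCMTwo_iff` (the crux is exactly "structure ∧ main conjecture",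
  class-wide).
* §2 `kobayashiMainConjecture_two_one_iff_pollackRubinBody` — the crux's main-conjecture conjunct at a
  curve `A` is VERBATIM the conclusion of the Pollack–Rubin fact read at `p = 2`, `ε = 1` (guard
  deleted): what is missing is exactly the source's `p > 2`.
* §3 `constantCoeff_generator_eq_of_kobayashiMainConjecture_two_one` — the crux's prediction at the
  trivial character, EXACT: `char X⁺(A/ℚ_∞) = (g)` with `g(0) = L(A,1)/Ω_A` in `ℚ₂` (period ratio
  `ϖ` times `L♭(0) = [0]⁺_f`, `c♭ = 1` at `a₂ = 0`, Pollack pair at `2` = Sprung pair).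
* §4 `valuation_constantCoeff_generator_eq_of_bsdp_two` — THE CONVERSE OF THE TREE DOOR
  `bsdp_two_of_kobayashiMainConjecture_two_of_frobeniusTrace_eq_zero` AT `T = 0`: for `E` good
  supersingular at `2` with `L(E,1) ≠ 0`, BSD₂(E) + GZK + B. D. Kim's control term at `2` (research
  binder, verbatim the `p = 2` body used by the door and by crux K4c `SignedControlAtTwo`) force EVERY
  generator `g` of `char X⁺(E/ℚ_∞)` (granted f.g. torsion) to satisfy `ord₂ g(0) = ord₂ (L(E,1)/Ω_E)`;
  `…_of_hasCM` specialises to CM `A` through Burungale–Flach (tree fact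
  `bsdTriple_of_hasCM_of_L_one_ne_zero`, BSD for CM rank `0` at EVERY prime incl. `2`).
* §5 `twoPowerDefect_eq_zero_of_bsdp_two` — consequently the feared `2`-power defect of the crux
  ("`Char X⁺ = (2ᵏ·L⁺)`", why-might-fail of item 20307) is ZERO at the trivial character granted
  Kim's control at `2` verbatim: if `char X⁺ = (g)` with `ι g = 2ᵏ·ϖ·ι L♭` then `k = 0`. The K2
  hazard and the K4c hazard are ONE hazard at `T = 0`.

References: [PollackRubin2004] Thm. 7.3, §1; [Kobayashi2003] Def. 1.1, Thm. 1.2, (3.6), Conjecture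
p. 2; [BDKim2013] Cor. 3.15; [Sprung2017] §1.1, Thm. 1.12, Cor. 4.4, Cor. 4.11; [BurungaleFlach2024]
Thm. 1.1; Kurihara–Otsuki, PAMQ 2 (2006) p. 557; [Miller2011LMS] Def. 1.1.
-/

set_option autoImplicit false
-- the Theorems namespace of this sub repeats the summit name by design (D-0017 nested layout)
set_option linter.dupNamespace false

noncomputable section

open scoped Classical MatrixGroups ModularForm

open CongruenceSubgroup WeierstrassCurve Literature.NumberTheory.EllipticCurves
  Literature.NumberTheory.EllipticCurves.ModularForms Literature.NumberTheory.EllipticCurves.Sprung2017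
  Literature.NumberTheory.EllipticCurves.Rank1Residual Literature.NumberTheory.EllipticCurves.Rank1Residual.Typed
  Literature.NumberTheory.EllipticCurves.Kobayashi2003 ZpExtension
  Summit.BirchSwinnertonDyer.Rank1Residual Summit.BirchSwinnertonDyer.Rank1Residual.Supersingular

namespace Summit.BirchSwinnertonDyer.BirchSwinnertonDyer.Theorems

/-! ## §1. The BC3 composition against the route decl -/

section Composition

/-- **BC3 composition (kernel-checked, no content of its own).** The two registered stubs of the
birth skeleton of crux K2 — `stub_cmSignedStructureTwo` (for a CM curve `A/ℚ` good supersingular at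
`2` with `a₂ = 0`: `X⁺(A/ℚ_∞)` finitely generated, `Λ`-torsion, `μ⁺ = 0`, for every cyclotomic
`ℤ₂`-extension datum and every Pontryagin-dual datum) and `stub_cmSignedMainConjectureTwo`
(Kobayashi's `+` main conjecture for `A` at `2`, the tree's typed `KobayashiMainConjecture A 2 1`) —
displayed as hypotheses, imply the route decl `SignedMainConjectureCMTwo` BY NAME. Neither stub is in
print at `p = 2` (Pollack–Rubin 2004 and Kobayashi 2003 assume `p` odd). Composition certificate;
nothing asserted. [cite: PollackRubin2004, Thm. 7.3 and §1 (p > 2)] [cite: Kobayashi2003, Thm. 1.2 (p odd)] -/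
theorem signedMainConjectureCMTwo_of_structure_of_mainConjecture
    (hS : ∀ (A : WeierstrassCurve ℚ) [A.IsElliptic] [A.IsGloballyMinimal],
      A.HasCM → GoodSS A 2 → A.frobeniusTrace 2 = 0 →
      ∀ (κ : ZpExtension ℚ 2) (γ : Field.absoluteGaloisGroup ℚ), κ.IsCyclotomic → κ.IsTopGenerator γ →
      ∀ (D : SignedSelmerDualData A κ γ 1),
        Module.Finite (IwasawaAlgebra 2) D.X ∧ Module.IsTorsion (IwasawaAlgebra 2) D.X ∧ D.mu = 0)
    (hMC : ∀ (A : WeierstrassCurve ℚ) [A.IsElliptic] [A.IsGloballyMinimal],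
      A.HasCM → GoodSS A 2 → A.frobeniusTrace 2 = 0 → KobayashiMainConjecture A 2 1) :
    Summit.BirchSwinnertonDyer.BirchSwinnertonDyer.Theses.ThetaPartnerAtTwo.SignedMainConjectureCMTwo := by
  intro A _ _ hcm hss ha
  refine ⟨fun κ γ hκ hγ D => ?_, hMC A hcm hss ha⟩
  obtain ⟨-, htor, hmu⟩ := hS A hcm hss ha κ γ hκ hγ D
  exact ⟨htor, hmu⟩

/-- **The crux is exactly "structure ∧ main conjecture", class-wide**: `SignedMainConjectureCMTwo`
unfolds to the conjunction, over every CM `A/ℚ` good supersingular at `2` with `a₂ = 0`, of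
(i) `X⁺(A/ℚ_∞)` `Λ`-torsion with `μ⁺ = 0` for every cyclotomic datum `(κ, γ)` and every dual datum,
and (ii) `KobayashiMainConjecture A 2 1`. Unfolding; nothing asserted.
[cite: PollackRubin2004, Thm. 7.3 (shape only; p > 2 in print)] -/
theorem signedMainConjectureCMTwo_iff :
    Summit.BirchSwinnertonDyer.BirchSwinnertonDyer.Theses.ThetaPartnerAtTwo.SignedMainConjectureCMTwo ↔
      (∀ (A : WeierstrassCurve ℚ) [A.IsElliptic] [A.IsGloballyMinimal],
        A.HasCM → GoodSS A 2 → A.frobeniusTrace 2 = 0 →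
        ∀ (κ : ZpExtension ℚ 2) (γ : Field.absoluteGaloisGroup ℚ), κ.IsCyclotomic → κ.IsTopGenerator γ →
        ∀ (D : SignedSelmerDualData A κ γ 1),
          Module.IsTorsion (IwasawaAlgebra 2) D.X ∧ D.mu = 0) ∧
      (∀ (A : WeierstrassCurve ℚ) [A.IsElliptic] [A.IsGloballyMinimal],
        A.HasCM → GoodSS A 2 → A.frobeniusTrace 2 = 0 → KobayashiMainConjecture A 2 1) := by
  constructor
  · intro h
    exact ⟨fun A _ _ hcm hss ha => (h A hcm hss ha).1, fun A _ _ hcm hss ha => (h A hcm hss ha).2⟩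
  · rintro ⟨hS, hMC⟩ A _ _ hcm hss ha
    exact ⟨hS A hcm hss ha, hMC A hcm hss ha⟩

end Composition

/-! ## §2. The main-conjecture conjunct is the Pollack–Rubin body read at `p = 2`, `ε = +` -/

section PollackRubinAtTwo

variable (A : WeierstrassCurve ℚ) [A.IsElliptic] [A.IsGloballyMinimal]

/-- **`KobayashiMainConjecture A 2 1` is VERBATIM the conclusion of the Pollack–Rubin named fact
`PollackRubin2004.mainTheorem_signedCharIdeal_eq_of_cm` read at `p = 2`, `ε = 1`** (its Pollack-pair
binder is the body of `IsPollackPair f 2`, its `if ε = 1 then L⁻ else L⁺` is `kobayashiL 1`): the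
fact's own hypothesis `p ≠ 2` (the source's §1: "Fix also a rational prime `p > 2`") is exactly what
separates crux K2's second conjunct from print. Definitional unfolding (`Iff.rfl`); nothing asserted.
[cite: PollackRubin2004, Thm. 7.3 and §1] [cite: Kobayashi2003, Conjecture (p. 2) and (3.6)] -/
theorem kobayashiMainConjecture_two_one_iff_pollackRubinBody [Fact (Nat.Prime 2)] :
    KobayashiMainConjecture A 2 1 ↔
    ∀ (κ : ZpExtension ℚ 2) (γ : Field.absoluteGaloisGroup ℚ),
        κ.IsCyclotomic → κ.IsTopGenerator γ → IsCyclotomicVariable 2 γ →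
      ∀ [NeZero (A.conductorNorm ℤ)] (f : CuspForm (Gamma0 (A.conductorNorm ℤ)) 2),
        IsNewformOf A f → ∀ (ϖ : ℚ), (ϖ : ℝ) * A.realPeriodRat = plusPeriod f →
      ∀ (Lplus Lminus : IwasawaAlgebra 2),
        (Lplus ≠ 0 ∧ Lminus ≠ 0 ∧
          (∀ n : ℕ, Odd n →
            IsCongrModOmega 2 n (mazurTateElement f 2 n)
              ((-1) ^ (n / 2 + 1) * cyclotomicOmegaPlus 2 n) Lplus) ∧
          (∀ n : ℕ, Even n →
            IsCongrModOmega 2 n (mazurTateElement f 2 n)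
              ((-1) ^ (n / 2 + 1) * cyclotomicOmegaMinus 2 n) Lminus)) →
      ∀ (D : SignedSelmerDualData A κ γ 1), Module.IsTorsion (IwasawaAlgebra 2) D.X ∧
        ∃ g : IwasawaAlgebra 2, D.charIdeal = Ideal.span {g} ∧
          iwasawaToPowerSeries 2 g =
            PowerSeries.C (ϖ : ℚ_[2]) * iwasawaToPowerSeries 2 (if (1 : ℤˣ) = 1 then Lminus else Lplus) :=
  Iff.rfl

end PollackRubinAtTwo

/-! ## §3. The crux's prediction at the trivial character, exact -/

section TrivialCharacter

variable (A : WeierstrassCurve ℚ) [A.IsElliptic] [A.IsGloballyMinimal]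

/-- **K2 at `T = 0`, EXACT.** Let `A = W` be globally minimal with good reduction at `2`, `a₂ = 0`
and `L(A,1) ≠ 0`, and grant modularity (`hmod`, PUB, by name). If `KobayashiMainConjecture A 2 1`
holds, then for every cyclotomic `ℤ₂`-extension `κ` with topological generator `γ` matching the
cyclotomic variable and every Pontryagin-dual datum `D` of `Sel⁺(A/ℚ_∞)`: `X⁺ = D.X` is `Λ`-torsion
and `char X⁺ = (g)` with `g(0) = L(A,1)/Ω_A` EXACTLY in `ℚ₂` (the rational `t` with
`L(A,1)/Ω_A = t`). Chain (the constant-term half of the tree door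
`bsdp_two_of_kobayashiMainConjecture_two_of_frobeniusTrace_eq_zero`, isolated): modularity gives the
newform `f` and the period ratio `ϖ` (`ϖ·Ω_A = Ω⁺_f`); a Pollack pair at `2` EXISTS
(`exists_isPollackPair_two`, Sprung's pair); the conjecture gives `ι g = ϖ·ι L♭`; at `a₂ = 0` the `♭`
constant is `c♭ = −a₂² + 2a₂ + 1 = 1` (`constantCoeff_flat_two_of_isSprungPair_of_isNewformOf`), so
`g(0) = ϖ·[0]⁺_f = L(A,1)/Ω_A`. No CM hypothesis is used. Nothing asserted beyond the binders.
[cite: Kobayashi2003, (3.6) and Conjecture (p. 2)] [cite: Sprung2017, Thm. 1.12 and Cor. 4.4] -/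
theorem constantCoeff_generator_eq_of_kobayashiMainConjecture_two_one
    (hmod : nonempty_modularParametrizationData)
    (hgood : A.HasGoodReductionAtPrime 2) (ha : A.frobeniusTrace 2 = 0)
    (hL : A.entireLFunction 1 ≠ 0) (hMC : KobayashiMainConjecture A 2 1)
    {κ : ZpExtension ℚ 2} {γ : Field.absoluteGaloisGroup ℚ} (hκ : κ.IsCyclotomic)
    (hγ : κ.IsTopGenerator γ) (hγ' : IsCyclotomicVariable 2 γ) (D : SignedSelmerDualData A κ γ 1) :
    Module.IsTorsion (IwasawaAlgebra 2) D.X ∧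
      ∃ (g : IwasawaAlgebra 2) (t : ℚ), D.charIdeal = Ideal.span {g} ∧
        A.entireLFunction 1 / (A.realPeriodRat : ℂ) = (t : ℂ) ∧
        ((PowerSeries.constantCoeff g : ℤ_[2]) : ℚ_[2]) = ((t : ℚ) : ℚ_[2]) := by
  -- modularity: the newform `f` of `A` and the period ratio `ϖ`
  haveI : NeZero (A.conductorNorm ℤ) := ⟨(A.conductorNorm_pos_holds).ne'⟩
  obtain ⟨Dm⟩ := hmod A
  set f := Dm.f with hf_def
  have hf : IsNewformOf A f := Dm.isNewformOf
  obtain ⟨ϖ, hϖpos, hϖeq, hΩpos⟩ := Dm.exists_rat_mul_realPeriodRat_eq_plusPeriod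
  -- `t = ϖ · [0]⁺_f = L(A,1)/Ω_A`
  set s : ℚ := ratPlusSymbol f 0 with hs_def
  set t : ℚ := ϖ * s with ht_def
  have hLval : A.entireLFunction 1 = (((s : ℝ) * plusPeriod f : ℝ) : ℂ) := hf.entireLFunction_one_eq
  have ht : A.entireLFunction 1 / (A.realPeriodRat : ℂ) = ((t : ℚ) : ℂ) := by
    rw [hLval, ← hϖeq, div_eq_iff (Complex.ofReal_ne_zero.mpr hΩpos.ne'), ht_def]
    push_cast
    ring
  -- the Pollack pair at `2` (Sprung's pair) and the conjecture
  obtain ⟨Ls, Lf, hSP, hPP⟩ := exists_isPollackPair_two hf hgood ha hL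
  obtain ⟨hTors, g, hchar, hιg⟩ := hMC κ γ hκ hγ hγ' f hf ϖ hϖeq Ls Lf hPP D
  have hkL : kobayashiL (1 : ℤˣ) Ls Lf = Lf := by unfold kobayashiL; rw [if_pos rfl]
  rw [hkL] at hιg
  -- constant terms: `g(0) = ϖ · L♭(0) = ϖ · [0]⁺_f = t` (`c♭ = 1` at `a₂ = 0`)
  have hLf0 := constantCoeff_flat_two_of_isSprungPair_of_isNewformOf hf hgood hSP
  rw [ha] at hLf0
  refine ⟨hTors, g, t, hchar, ht, ?_⟩
  have hc := congrArg PowerSeries.constantCoeff hιg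
  rw [constantCoeff_iwasawaToPowerSeries, map_mul, PowerSeries.constantCoeff_C,
    constantCoeff_iwasawaToPowerSeries, hLf0] at hc
  rw [hc, ht_def]
  push_cast
  ring

end TrivialCharacter

/-! ## §4. The converse of the door at `T = 0`: BSD₂ + Kim's control at `2` ⇒ `ord₂ g(0) = ord₂ L(E,1)/Ω_E` -/

section Converse

variable (A : WeierstrassCurve ℚ) [A.IsElliptic] [A.IsGloballyMinimal]

/-- **The `T = 0` shadow of the signed main conjecture at `2`, from BSD₂ and control.** Let `E = W`
be globally minimal, good supersingular at `2` (`GoodSS W 2`, so `E(ℚ)[2] = 0`: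
`P2.irr_two_of_goodSS_two`) with `L(E,1) ≠ 0`, write `L(E,1)/Ω_E = t ∈ ℚ`, and grant GZK (`hGZK`,
PUB, by name), `BSD(E,2)` (`hBSD`, Miller's `BSDp W 2`), and B. D. Kim's control term at `2` (`hKim`:
`g(0) ∼ 2^{v₂ ∏c_ℓ}·#Sel_{2^∞}(E/ℚ)` for a generator `g` of `char X⁺`, VERBATIM the `p = 2` body of
the tree door and of crux K4c — a research binder, Kim 2013 Cor. 3.15 being printed for odd `p`).
Then for every cyclotomic datum `(κ, γ)`, every f.g. `Λ`-torsion dual datum `D` of `Sel⁺(E/ℚ_∞)` and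
every generator `g` of `char X⁺ = D.charIdeal`: `g(0) ≠ 0` and `ord₂ g(0) = ord₂ t`. Chain: Kim + GZK
(`#Sel_{2^∞} = #Ш[2^∞]`, `valuation_constantCoeff_xi`) give `ord₂ g(0) = ord₂ ∏c_ℓ + ord₂ #Ш`;
`BSD(E,2)` gives `#Ш_an ∈ ℚ` with `ord₂ #Ш_an = ord₂ #Ш` (`missingPPartAt_of_bsdp`), and
`#Ш_an = t·#tors²/∏c_ℓ` (`shaAn_eq_of_analyticRank_eq_zero`) with `2 ∤ #tors`, so
`ord₂ t = ord₂ ∏c_ℓ + ord₂ #Ш`. This is the CONVERSE, at the trivial character, of the door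
`bsdp_two_of_kobayashiMainConjecture_two_of_frobeniusTrace_eq_zero` (there: conjecture + Kim ⇒ BSD₂).
Nothing asserted beyond the binders. [cite: BDKim2013, Cor. 3.15 (p. 199; p odd in print)]
[cite: Miller2011LMS, Def. 1.1] [cite: Kobayashi2003, Thm. 1.2 (the object only)] -/
theorem valuation_constantCoeff_generator_eq_of_bsdp_two
    (hGZK : rank_eq_analyticRank_of_analyticRank_le_one)
    (hss : GoodSS A 2) (hL : A.entireLFunction 1 ≠ 0) (hBSD : BSDp A 2)
    (hKim : ∀ (κ : ZpExtension ℚ 2) (γ : Field.absoluteGaloisGroup ℚ),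
      κ.IsCyclotomic → κ.IsTopGenerator γ →
      ∀ (D : SignedSelmerDualData A κ γ 1) [Module.Finite (IwasawaAlgebra 2) D.X],
        Module.IsTorsion (IwasawaAlgebra 2) D.X →
      ∀ g : IwasawaAlgebra 2, D.charIdeal = Ideal.span {g} → Finite (A.selmerGroupPInfty 2) →
        ∃ u : ℤ_[2]ˣ, ((PowerSeries.constantCoeff g : ℤ_[2]) : ℚ_[2]) =
          ((u : ℤ_[2]) : ℚ_[2]) * ((2 : ℕ) : ℚ_[2]) ^ (padicValNat 2 A.tamagawaProduct) *
            (Nat.card (A.selmerGroupPInfty 2) : ℚ_[2]))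
    {κ : ZpExtension ℚ 2} {γ : Field.absoluteGaloisGroup ℚ} (hκ : κ.IsCyclotomic)
    (hγ : κ.IsTopGenerator γ) (D : SignedSelmerDualData A κ γ 1)
    [Module.Finite (IwasawaAlgebra 2) D.X] (hTors : Module.IsTorsion (IwasawaAlgebra 2) D.X)
    {g : IwasawaAlgebra 2} (hchar : D.charIdeal = Ideal.span {g})
    {t : ℚ} (ht : A.entireLFunction 1 / (A.realPeriodRat : ℂ) = (t : ℂ)) :
    ((PowerSeries.constantCoeff g : ℤ_[2]) : ℚ_[2]) ≠ 0 ∧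
      (((PowerSeries.constantCoeff g : ℤ_[2]) : ℚ_[2])).valuation = padicValRat 2 t := by
  have hr : A.analyticRank = 0 := analyticRank_eq_zero_of_entireLFunction_one_ne_zero A hL
  have hirr : A.HasIrreducibleModPGaloisRep 2 := P2.irr_two_of_goodSS_two A hss
  -- `t ≠ 0`
  have hΩ : (A.realPeriodRat : ℂ) ≠ 0 := Complex.ofReal_ne_zero.mpr A.realPeriodRat_pos_holds.ne'
  have ht0 : t ≠ 0 := by
    rintro rfl
    apply hL
    have h := ht
    rw [div_eq_iff hΩ] at h
    rw [h]
    simp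
  -- Kim + GZK: `g(0) ≠ 0`, `ord₂ g(0) = ord₂ ∏c + ord₂ #Ш`
  have hK : (⟨g, 0, 0⟩ : SignedDatum A 2).EulerCharacteristic := fun hfin ↦
    hKim κ γ hκ hγ D hTors g hchar hfin
  obtain ⟨hne, hvg⟩ := valuation_constantCoeff_xi A 2 hGZK hL ⟨g, 0, 0⟩ hK
  -- BSD₂: `ord₂ #Ш_an = ord₂ #Ш` with `#Ш_an = t·#tors²/∏c`
  haveI : Finite A.sha := (hGZK A (by omega)).2
  obtain ⟨q, hq, hv⟩ := missingPPartAt_of_bsdp A 2 hBSD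
  have hsha := shaAn_eq_of_analyticRank_eq_zero A hGZK hr ht
  have hqt : q = t * (A.torsionOrder : ℚ) ^ 2 / (A.tamagawaProduct : ℚ) := by
    have h := hq.symm.trans hsha
    exact_mod_cast h
  rw [hqt, padicValRat_shaAn_witness A 2 hirr ht0] at hv
  refine ⟨hne, ?_⟩
  rw [hvg]
  linarith

/-- **CM specialisation (crux K2's class, rank `0`).** For a CM curve `A/ℚ` (globally minimal) good
supersingular at `2` with `L(A,1) ≠ 0`, `BSD(A,2)` IS IN PRINT: Burungale–Flach 2024 (tree fact
`bsdTriple_of_hasCM_of_L_one_ne_zero`, the full BSD formula for CM curves with `L(E,1) ≠ 0` at every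
prime, `hBF`) with `forall_bsdp_of_bsdTriple`. Hence, granted GZK (`hGZK`) and Kim's control term at
`2` for `A` (`hKim`, research binder), every generator `g` of `char X⁺(A/ℚ_∞)` (f.g. torsion datum)
has `ord₂ g(0) = ord₂ (L(A,1)/Ω_A)` — which is what crux K2 predicts at `T = 0`
(`constantCoeff_generator_eq_of_kobayashiMainConjecture_two_one`). So at the trivial character the
crux is CONSISTENT with everything in print, and its `μ⁺ = 0 ∧ char X⁺ = (ϖ L♭)` normalisation is the
one compatible with Kim's control term taken verbatim at `2`. Nothing asserted beyond the binders.
[cite: BurungaleFlach2024, Thm. 1.1] [cite: BDKim2013, Cor. 3.15 (p odd in print)] [cite: Miller2011LMS, Def. 1.1] -/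
theorem valuation_constantCoeff_generator_eq_of_hasCM
    (hBF : bsdTriple_of_hasCM_of_L_one_ne_zero)
    (hGZK : rank_eq_analyticRank_of_analyticRank_le_one)
    (hcm : A.HasCM) (hss : GoodSS A 2) (hL : A.entireLFunction 1 ≠ 0)
    (hKim : ∀ (κ : ZpExtension ℚ 2) (γ : Field.absoluteGaloisGroup ℚ),
      κ.IsCyclotomic → κ.IsTopGenerator γ →
      ∀ (D : SignedSelmerDualData A κ γ 1) [Module.Finite (IwasawaAlgebra 2) D.X],
        Module.IsTorsion (IwasawaAlgebra 2) D.X →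
      ∀ g : IwasawaAlgebra 2, D.charIdeal = Ideal.span {g} → Finite (A.selmerGroupPInfty 2) →
        ∃ u : ℤ_[2]ˣ, ((PowerSeries.constantCoeff g : ℤ_[2]) : ℚ_[2]) =
          ((u : ℤ_[2]) : ℚ_[2]) * ((2 : ℕ) : ℚ_[2]) ^ (padicValNat 2 A.tamagawaProduct) *
            (Nat.card (A.selmerGroupPInfty 2) : ℚ_[2]))
    {κ : ZpExtension ℚ 2} {γ : Field.absoluteGaloisGroup ℚ} (hκ : κ.IsCyclotomic)
    (hγ : κ.IsTopGenerator γ) (D : SignedSelmerDualData A κ γ 1)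
    [Module.Finite (IwasawaAlgebra 2) D.X] (hTors : Module.IsTorsion (IwasawaAlgebra 2) D.X)
    {g : IwasawaAlgebra 2} (hchar : D.charIdeal = Ideal.span {g})
    {t : ℚ} (ht : A.entireLFunction 1 / (A.realPeriodRat : ℂ) = (t : ℂ)) :
    ((PowerSeries.constantCoeff g : ℤ_[2]) : ℚ_[2]) ≠ 0 ∧
      (((PowerSeries.constantCoeff g : ℤ_[2]) : ℚ_[2])).valuation = padicValRat 2 t :=
  valuation_constantCoeff_generator_eq_of_bsdp_two A hGZK hss hL
    (forall_bsdp_of_bsdTriple A A.tamagawaProduct_pos_holds (hBF A hcm hL) 2 Nat.prime_two)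
    hKim hκ hγ D hTors hchar ht

end Converse

/-! ## §5. No `2`-power defect at the trivial character -/

section Defect

variable (A : WeierstrassCurve ℚ) [A.IsElliptic] [A.IsGloballyMinimal]

/-- **The `2`-power defect of crux K2 is zero at `T = 0`, granted BSD₂ and Kim's control at `2`.**
In the setting of `valuation_constantCoeff_generator_eq_of_bsdp_two` (good supersingular at `2`,
`a₂ = 0`, `L(E,1) ≠ 0`; GZK, `BSD(E,2)`, Kim's control term at `2`), let `f` be the newform of `E`
with period ratio `ϖ` (`ϖ·Ω_E = Ω⁺_f`), `(L⁺, L⁻)` ANY Pollack pair at `2` (at `a₂ = 0` it is a Sprung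
pair, `isSprungPair_zero_iff`, so `L⁻(0) = L♭(0) = [0]⁺_f`), `D` a f.g. torsion dual datum of
`Sel⁺(E/ℚ_∞)` and `g` a generator of `char X⁺`. If `ι g = 2ᵏ·ϖ·ι L♭` — the crux's identity
DEFORMED by the feared power of `2` (why-might-fail of item 20307: "`Char X⁺ = (2ᵏ·L⁺)`") — then
`k = 0`: `g(0) = 2ᵏ·t`, `ord₂ g(0) = k + ord₂ t`, against `ord₂ g(0) = ord₂ t`. So a `2`-power in the
`+` main conjecture at `2` can only coexist with a compensating `2`-power in Kim's control term at `2`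
(crux K4c): ONE hazard, not two. Nothing asserted beyond the binders.
[cite: Kobayashi2003, Conjecture (p. 2) and (3.6)] [cite: Sprung2017, Thm. 1.12, Cor. 4.4]
[cite: BDKim2013, Cor. 3.15 (p odd in print)] -/
theorem twoPowerDefect_eq_zero_of_bsdp_two
    (hGZK : rank_eq_analyticRank_of_analyticRank_le_one)
    (hss : GoodSS A 2) (ha : A.frobeniusTrace 2 = 0) (hL : A.entireLFunction 1 ≠ 0) (hBSD : BSDp A 2)
    (hKim : ∀ (κ : ZpExtension ℚ 2) (γ : Field.absoluteGaloisGroup ℚ),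
      κ.IsCyclotomic → κ.IsTopGenerator γ →
      ∀ (D : SignedSelmerDualData A κ γ 1) [Module.Finite (IwasawaAlgebra 2) D.X],
        Module.IsTorsion (IwasawaAlgebra 2) D.X →
      ∀ g : IwasawaAlgebra 2, D.charIdeal = Ideal.span {g} → Finite (A.selmerGroupPInfty 2) →
        ∃ u : ℤ_[2]ˣ, ((PowerSeries.constantCoeff g : ℤ_[2]) : ℚ_[2]) =
          ((u : ℤ_[2]) : ℚ_[2]) * ((2 : ℕ) : ℚ_[2]) ^ (padicValNat 2 A.tamagawaProduct) *
            (Nat.card (A.selmerGroupPInfty 2) : ℚ_[2]))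
    {κ : ZpExtension ℚ 2} {γ : Field.absoluteGaloisGroup ℚ} (hκ : κ.IsCyclotomic)
    (hγ : κ.IsTopGenerator γ) (D : SignedSelmerDualData A κ γ 1)
    [Module.Finite (IwasawaAlgebra 2) D.X] (hTors : Module.IsTorsion (IwasawaAlgebra 2) D.X)
    [NeZero (A.conductorNorm ℤ)] {f : CuspForm (Gamma0 (A.conductorNorm ℤ)) 2} (hf : IsNewformOf A f)
    {ϖ : ℚ} (hϖ : (ϖ : ℝ) * A.realPeriodRat = plusPeriod f)
    {Lplus Lminus : IwasawaAlgebra 2} (hPP : IsPollackPair f 2 Lplus Lminus)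
    {g : IwasawaAlgebra 2} (hchar : D.charIdeal = Ideal.span {g}) {k : ℕ}
    (hιg : iwasawaToPowerSeries 2 g =
      PowerSeries.C ((2 : ℚ_[2]) ^ k * (ϖ : ℚ_[2])) *
        iwasawaToPowerSeries 2 (kobayashiL 1 Lplus Lminus)) :
    k = 0 := by
  -- the period ratio is positive, so `t = ϖ · [0]⁺_f` is `L(A,1)/Ω_A`
  have hΩpos : 0 < A.realPeriodRat := A.realPeriodRat_pos_holds
  have hkL : kobayashiL (1 : ℤˣ) Lplus Lminus = Lminus := by unfold kobayashiL; rw [if_pos rfl]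
  rw [hkL] at hιg
  set s : ℚ := ratPlusSymbol f 0 with hs_def
  set t : ℚ := ϖ * s with ht_def
  have hLval : A.entireLFunction 1 = (((s : ℝ) * plusPeriod f : ℝ) : ℂ) := hf.entireLFunction_one_eq
  have ht : A.entireLFunction 1 / (A.realPeriodRat : ℂ) = ((t : ℚ) : ℂ) := by
    rw [hLval, ← hϖ, div_eq_iff (Complex.ofReal_ne_zero.mpr hΩpos.ne'), ht_def]
    push_cast
    ring
  -- at `a₂ = 0` a Pollack pair at `2` is a Sprung pair, so `L⁻(0) = [0]⁺_f`
  have hSP : IsSprungPair f 2 (A.frobeniusTrace 2) Lplus Lminus := by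
    rw [ha]
    exact (isSprungPair_zero_iff f 2 Lplus Lminus).mpr ⟨hPP.2.2.1, hPP.2.2.2⟩
  have hLf0 := constantCoeff_flat_two_of_isSprungPair_of_isNewformOf hf hss.1 hSP
  rw [ha] at hLf0
  -- constant terms: `g(0) = 2ᵏ · t`
  have hg0 : ((PowerSeries.constantCoeff g : ℤ_[2]) : ℚ_[2]) =
      (2 : ℚ_[2]) ^ k * ((t : ℚ) : ℚ_[2]) := by
    have hc := congrArg PowerSeries.constantCoeff hιg
    rw [constantCoeff_iwasawaToPowerSeries, map_mul, PowerSeries.constantCoeff_C,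
      constantCoeff_iwasawaToPowerSeries, hLf0] at hc
    rw [hc, ht_def]
    push_cast
    ring
  -- valuations: `k + ord₂ t = ord₂ t`
  obtain ⟨hne, hval⟩ := valuation_constantCoeff_generator_eq_of_bsdp_two A hGZK hss hL hBSD hKim hκ hγ
    D hTors hchar ht
  have ht0 : ((t : ℚ) : ℚ_[2]) ≠ 0 := by
    intro h0
    exact hne (by rw [hg0, h0, mul_zero])
  have h2k : ((2 : ℚ_[2]) ^ k) = ((2 ^ k : ℕ) : ℚ_[2]) := by norm_cast
  have h2k0 : ((2 : ℚ_[2]) ^ k) ≠ 0 := pow_ne_zero _ (by norm_num)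
  rw [hg0, Padic.valuation_mul h2k0 ht0, Padic.valuation_ratCast, h2k, Padic.valuation_natCast,
    padicValNat.prime_pow] at hval
  omega

end Defect

end Summit.BirchSwinnertonDyer.BirchSwinnertonDyer.Theorems

end
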